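/-
Copyright (c) 2026 the pub-hodgecm-mathlib formalisation cell (harness21).  Prover seat hodgecm-mathlib-K2Liu-p09 (g6): Track B «K2-LIT»,
hLiu418 = stmt-HodgeConjecture-24832; LEAD F0P6-plan RULING M-158d «A7-val road (σ)», instance layer I-1a (the partner embedding `g ↦ 1 ⊗ g`).
-/
import Literature.NumberTheory.GelbartRogawski1991.LocalDoubledKroneckerEmbedding   -- ★ `kronOneGL`, `kronOneInl`, `placeForm_reindex_kronecker_general`, `mem_localPi_iff`
import HarnessLib

/-!
# Crux `HLiu418`, road `K2_Liu`, organ A7-val, instance layer I-1a: THE PARTNER EMBEDDING `U(J_W)(F_v) →* U(J_V ⊗ J_W)(F_v)`, `g ↦ 1_V ⊗ g`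

Cell `hodgecm-mathlib`, crux item hLiu418 = `stmt-HodgeConjecture-24832`; squad K2 ∕ K2Liu; prover K2Liu-p09 (g6), organ lead A7-val.  DEFINITION LANE
(`--supports stmt-HodgeConjecture-24832 --as helper`): DEFINITIONS WITH BODIES + their API; no instance, no notation, no sorry.  Generic over a quadratic
extension `E ∕ F` of number fields, sizes `N, m` and an enumeration `e : Fin N × Fin m ≃ Fin n`, every finite place `v` of `F`.  The twin of ★ GR
`kronOneGL ∕ kronOneInl` (`k ↦ k ⊗ 1_m`, the FIRST member of the dual pair `U(J_V) × U(J_W) → U(J_V ⊗ J_W)`): here the SECOND member.  At the big datum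
of the (A4″-KR) face (`J_V = J^𝔻` the doubled Gram of the small datum, `J_W = diag dV′`, `e = epsD`) this is the `U(V′_v)`-action `1 ⊗ g` on `𝔻 ⊗ V′` whose
`D`-block in ★ β-1's Δ-model is the `ρ` of ★ V8c∕V8e (files I-1b∕I-2).
* §1 **`oneKronGLPi v : Π_{w∣v} GL_m(E_w) →* Π_{w∣v} GL_n(E_w)`**, `g ↦ (reindex e (1_N ⊗ₖ g_w))_w`; its matrices, continuity, its form identity, and
  **`oneKronGLPi_mem`**: `g ∈ U(J_W)(F_v) ⇒ 1 ⊗ g ∈ U(reindex e (J_V ⊗ₖ J_W))(F_v)`; **`oneKronInr v : U(J_W)(F_v) →* U(reindex e (J_V ⊗ₖ J_W))(F_v)`**, continuous.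
* §2 **`commute_kronOneGL_oneKronGLPi`** — `(k ⊗ 1)(1 ⊗ g) = (1 ⊗ g)(k ⊗ 1)` (both are `k ⊗ g` place by place): the two members of the dual pair commute.
HONEST LABEL.  `HC_CM` is proved only modulo the 7 printed citations (2 remaining named inputs: hLiu418 = `stmt-HodgeConjecture-24832`,
h413 = `stmt-HodgeConjecture-24833`) until rung 0 closes.

## References
* [MoeglinVignerasWaldspurger1987] C. Mœglin, M.-F. Vignéras, J.-L. Waldspurger, LNM 1291, Chap. 1 I.17 (dual pairs `U(V) × U(W) → Sp(V ⊗ W)`).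
* [GelbartRogawski1991] S. Gelbart, J. Rogawski, Invent. Math. 105 (1991), §3.2 p. 457.
* [Kudla1994] S. Kudla, Israel J. Math. 87 (1994), §2.
-/

set_option autoImplicit false

noncomputable section

open scoped Matrix Kronecker
open NumberField IsDedekindDomain Matrix
open Literature.NumberTheory.Automorphic Literature.NumberTheory.Automorphic.UnitaryGroup
open Literature.NumberTheory.GelbartRogawski1991.UnitaryDualPair.LocalSplitting

set_option linter.dupNamespace false -- the mandated namespace repeats `HodgeConjecture.HodgeConjecture`

namespace Summit.HodgeConjecture.HodgeConjecture.Cruxes.HLiu418.K2LiuOneKronEmbedding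

variable (E : Type) [Field E] [NumberField E]

/-! ## §1 `g ↦ reindex e (1_N ⊗ₖ g)` on the local factors, and into the unitary group -/

/-- `(g_w)_w ↦ (reindex e (1_N ⊗ₖ g_w))_w` on `Π_{w ∣ v} GL_m(E_w) → Π_{w ∣ v} GL_n(E_w)` — the second member of the dual pair, on the factor form.
[cite: MoeglinVignerasWaldspurger1987, Chap. 1 I.17] -/
def oneKronGLPi (N m : ℕ) {n : ℕ} (e : Fin N × Fin m ≃ Fin n) {F : Type} [Field F] [NumberField F] [Algebra F E]
    (v : HeightOneSpectrum (𝓞 F)) : LocalGLPi E m v →* LocalGLPi E n v where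
  toFun g w := UnitaryGroup.reindexGL e (kroneckerGL ((1 : GL (Fin N) (w.1.adicCompletion E)), g w))
  map_one' := funext fun w => by rw [Pi.one_apply, Pi.one_apply, ← Prod.one_eq_mk, map_one, map_one]
  map_mul' g g' := funext fun w => by rw [Pi.mul_apply, Pi.mul_apply, ← map_mul, ← map_mul, Prod.mk_mul_mk, mul_one]

/-- matrix of the `w`-component: `reindex e e (1 ⊗ₖ g_w)`. [cite: MoeglinVignerasWaldspurger1987, Chap. 1 I.17] -/
theorem coe_oneKronGLPi_apply (N m : ℕ) {n : ℕ} (e : Fin N × Fin m ≃ Fin n) {F : Type} [Field F] [NumberField F] [Algebra F E]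
    (v : HeightOneSpectrum (𝓞 F)) (g : LocalGLPi E m v) (w : PlacesOver E v) :
    ((oneKronGLPi E N m e v g w : GL (Fin n) (w.1.adicCompletion E)) : Matrix (Fin n) (Fin n) (w.1.adicCompletion E)) =
      Matrix.reindex e e ((1 : Matrix (Fin N) (Fin N) (w.1.adicCompletion E)) ⊗ₖ
        ((g w : GL (Fin m) (w.1.adicCompletion E)) : Matrix (Fin m) (Fin m) (w.1.adicCompletion E))) := by
  rw [show oneKronGLPi E N m e v g w = UnitaryGroup.reindexGL e (kroneckerGL (1, g w)) from rfl, UnitaryGroup.coe_reindexGL,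
    coe_kroneckerGL, Units.val_one]

/-- `oneKronGLPi` is continuous. [cite: MoeglinVignerasWaldspurger1987, Chap. 1 I.17] -/
theorem continuous_oneKronGLPi (N m : ℕ) {n : ℕ} (e : Fin N × Fin m ≃ Fin n) {F : Type} [Field F] [NumberField F] [Algebra F E]
    (v : HeightOneSpectrum (𝓞 F)) : Continuous (oneKronGLPi E N m e v) :=
  continuous_pi fun w => (UnitaryGroup.continuous_reindexGL e).comp
    (continuous_kroneckerGL.comp ((continuous_const.prodMk (continuous_apply w))))

/-- the unitarity expression of `reindex e (1_N ⊗ g)` at `w` is `reindex e (J_V ⊗ ((c_* g)ᵀ J_W g))`: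
`(c_*(1 ⊗ g))ᵀ (J_V ⊗ J_W) (1 ⊗ g) = (1ᵀ J_V 1) ⊗ ((c_* g)ᵀ J_W g)`. [cite: MoeglinVignerasWaldspurger1987, Chap. 1 I.17] -/
theorem oneKronGLPi_form (N m : ℕ) {n : ℕ} (e : Fin N × Fin m ≃ Fin n) {F : Type} [Field F] [NumberField F] [Algebra F E]
    (c : E ≃ₐ[F] E) (JV : Matrix (Fin N) (Fin N) E) (JW : Matrix (Fin m) (Fin m) E)
    (v : HeightOneSpectrum (𝓞 F)) (g : LocalGLPi E m v) (w : PlacesOver E v) :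
    (((oneKronGLPi E N m e v g (PlacesOver.galInv c w) : GL (Fin n) ((PlacesOver.galInv c w).1.adicCompletion E)) :
            Matrix (Fin n) (Fin n) ((PlacesOver.galInv c w).1.adicCompletion E)).map
          (galAdicCompletionMap c (smul_inv_smul c w.1)))ᵀ * placeForm (Matrix.reindex e e (JV ⊗ₖ JW)) w.1 *
        ((oneKronGLPi E N m e v g w : GL (Fin n) (w.1.adicCompletion E)) : Matrix (Fin n) (Fin n) (w.1.adicCompletion E)) =
      Matrix.reindex e e
        (placeForm JV w.1 ⊗ₖ
          ((((g (PlacesOver.galInv c w) : GL (Fin m) ((PlacesOver.galInv c w).1.adicCompletion E)) :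
                Matrix (Fin m) (Fin m) ((PlacesOver.galInv c w).1.adicCompletion E)).map
              (galAdicCompletionMap c (smul_inv_smul c w.1)))ᵀ * placeForm JW w.1 *
            ((g w : GL (Fin m) (w.1.adicCompletion E)) : Matrix (Fin m) (Fin m) (w.1.adicCompletion E)))) := by
  rw [coe_oneKronGLPi_apply, coe_oneKronGLPi_apply, placeForm_reindex_kronecker_general, Matrix.reindex_apply,
    Matrix.reindex_apply, Matrix.reindex_apply, Matrix.reindex_apply, ← Matrix.submatrix_map, Matrix.transpose_submatrix,
    ← kronecker_map_map, kronecker_transpose, Matrix.map_one _ (map_zero _) (map_one _), Matrix.transpose_one,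
    Matrix.submatrix_mul_equiv, Matrix.submatrix_mul_equiv, ← Matrix.mul_kronecker_mul, ← Matrix.mul_kronecker_mul, Matrix.one_mul, Matrix.mul_one]

/-- **`reindex e (1_N ⊗ g) ∈ U(J_V ⊗ J_W)(F_v)` for `g ∈ U(J_W)(F_v)`** (any `J_V ∈ M_N(E)`). [cite: MoeglinVignerasWaldspurger1987, Chap. 1 I.17] -/
theorem oneKronGLPi_mem (N m : ℕ) {n : ℕ} (e : Fin N × Fin m ≃ Fin n) {F : Type} [Field F] [NumberField F] [Algebra F E]
    (c : E ≃ₐ[F] E) (JV : Matrix (Fin N) (Fin N) E) (JW : Matrix (Fin m) (Fin m) E)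
    (v : HeightOneSpectrum (𝓞 F)) (g : localPi E c m JW v) :
    oneKronGLPi E N m e v (g : LocalGLPi E m v) ∈ localPi E c n (Matrix.reindex e e (JV ⊗ₖ JW)) v := by
  rw [mem_localPi_iff]
  intro w
  rw [oneKronGLPi_form, (mem_localPi_iff E c m JW v (g : LocalGLPi E m v)).1 g.2 w, placeForm_reindex_kronecker_general]

/-- **`oneKronInr … v : U(J_W)(F_v) →* U(J_V ⊗ J_W)(F_v)`, `g ↦ reindex e (1_N ⊗ g)`** — the second member of the dual pair
`U(J_V) × U(J_W) → U(J_V ⊗ J_W)` at the place `v` restricted to `1 × U(J_W)`; at the big datum of the (A4″-KR) face it is the `U(V′_v)`-action `1 ⊗ g`.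
[cite: MoeglinVignerasWaldspurger1987, Chap. 1 I.17] [cite: GelbartRogawski1991, §3.2 p. 457] -/
def oneKronInr (N m : ℕ) {n : ℕ} (e : Fin N × Fin m ≃ Fin n) {F : Type} [Field F] [NumberField F] [Algebra F E]
    (c : E ≃ₐ[F] E) (JV : Matrix (Fin N) (Fin N) E) (JW : Matrix (Fin m) (Fin m) E) (v : HeightOneSpectrum (𝓞 F)) :
    localPi E c m JW v →* localPi E c n (Matrix.reindex e e (JV ⊗ₖ JW)) v :=
  ((oneKronGLPi E N m e v).comp (localPi E c m JW v).subtype).codRestrict _ fun g => oneKronGLPi_mem E N m e c JV JW v g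

/-- underlying family of `oneKronInr v g`. [cite: MoeglinVignerasWaldspurger1987, Chap. 1 I.17] -/
@[simp] theorem coe_oneKronInr (N m : ℕ) {n : ℕ} (e : Fin N × Fin m ≃ Fin n) {F : Type} [Field F] [NumberField F] [Algebra F E]
    (c : E ≃ₐ[F] E) (JV : Matrix (Fin N) (Fin N) E) (JW : Matrix (Fin m) (Fin m) E) (v : HeightOneSpectrum (𝓞 F))
    (g : localPi E c m JW v) :
    ((oneKronInr E N m e c JV JW v g : localPi E c n (Matrix.reindex e e (JV ⊗ₖ JW)) v) : LocalGLPi E n v) =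
      oneKronGLPi E N m e v (g : LocalGLPi E m v) := rfl

/-- `g ↦ reindex e (1_N ⊗ g)` is continuous on `U(J_W)(F_v)`. [cite: MoeglinVignerasWaldspurger1987, Chap. 1 I.17] -/
theorem continuous_oneKronInr (N m : ℕ) {n : ℕ} (e : Fin N × Fin m ≃ Fin n) {F : Type} [Field F] [NumberField F] [Algebra F E]
    (c : E ≃ₐ[F] E) (JV : Matrix (Fin N) (Fin N) E) (JW : Matrix (Fin m) (Fin m) E) (v : HeightOneSpectrum (𝓞 F)) :
    Continuous (oneKronInr E N m e c JV JW v) :=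
  Topology.IsInducing.subtypeVal.continuous_iff.2 ((continuous_oneKronGLPi E N m e v).comp continuous_subtype_val)

/-! ## §2 The two members of the dual pair commute -/

/-- **`(k ⊗ 1)(1 ⊗ g) = (1 ⊗ g)(k ⊗ 1)`** in `Π_{w∣v} GL_n(E_w)` — both are `k ⊗ g` place by place. [cite: MoeglinVignerasWaldspurger1987, Chap. 1 I.17] -/
theorem commute_kronOneGL_oneKronGLPi (N m : ℕ) {n : ℕ} (e : Fin N × Fin m ≃ Fin n) {F : Type} [Field F] [NumberField F] [Algebra F E]
    (v : HeightOneSpectrum (𝓞 F)) (k : LocalGLPi E N v) (g : LocalGLPi E m v) :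
    Commute (kronOneGL E N m e v k) (oneKronGLPi E N m e v g) := by
  refine funext fun w => Units.ext ?_
  rw [Pi.mul_apply, Pi.mul_apply, Units.val_mul, Units.val_mul, coe_oneKronGLPi_apply, coe_kronOneGL_apply,
    Matrix.reindex_apply, Matrix.reindex_apply, Matrix.submatrix_mul_equiv, Matrix.submatrix_mul_equiv, ← Matrix.mul_kronecker_mul,
    ← Matrix.mul_kronecker_mul, Matrix.one_mul, Matrix.mul_one, Matrix.one_mul, Matrix.mul_one]

/-- the same inside `U(J_V ⊗ J_W)(F_v)`: `kronOneInl k` and `oneKronInr g` commute. [cite: MoeglinVignerasWaldspurger1987, Chap. 1 I.17] -/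
theorem commute_kronOneInl_oneKronInr (N m : ℕ) {n : ℕ} (e : Fin N × Fin m ≃ Fin n) {F : Type} [Field F] [NumberField F] [Algebra F E]
    (c : E ≃ₐ[F] E) (JV : Matrix (Fin N) (Fin N) E) (JW : Matrix (Fin m) (Fin m) E) (v : HeightOneSpectrum (𝓞 F))
    (k : localPi E c N JV v) (g : localPi E c m JW v) :
    Commute (kronOneInl E N m e c JV JW v k) (oneKronInr E N m e c JV JW v g) :=
  Subtype.ext (commute_kronOneGL_oneKronGLPi E N m e v (k : LocalGLPi E N v) (g : LocalGLPi E m v)).eq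

end Summit.HodgeConjecture.HodgeConjecture.Cruxes.HLiu418.K2LiuOneKronEmbedding

end
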